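import Literature.Computability.Cryptography.LWEPrimePowerIdeal
import Literature.Computability.Cryptography.LWEPrimePowerAggregate
import Literature.Computability.Cryptography.LWEPrimePowerSmoothing
import Literature.Computability.Cryptography.LWEPrimePowerTopSpec
import HarnessLib

/-!
# The Micciancio–Peikert reduction with Gaussian noise: closeness, rounding margin, and the failure bound (MP12, Thm. 3.1)

Topic `Computability/Cryptography` (LWE), grouping namespace `LWE.MP12`, sequel of
`LWEPrimePowerIdeal.lean` (`idealLaw`, `idealLaw_ne_le` with abstract `Close`, `δc`, `ρ`),
`LWEPrimePowerAggregate.lean` (the advantage under the aggregated noise `sumNoise Ψ̄_{α₁} K`) and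
`LWEPrimePowerSmoothing.lean` (hybrids above `η_ε(ℤ)` are close to uniform). Proved material (no named
fact) towards `Literature.Computability.Cryptography.blprs_gapSVP_sqrt_dim_to_lwe_classical`
(**pqc.S21**), component Thm. 2.17 = Micciancio–Peikert 2012, Thm. 3.1 (hypothesis `h₂` of
`BLPRSReduction.…_of_components`); ePrint 2011/501, pp. 15–16.

The noise laws: the raw noise `χ₁ = Ψ̄_{α₁}` (rate `α₁ = rate₁`), the aggregated noise
`χK = sumNoise Ψ̄_{α₁} K` facing the distinguisher (within `ΔK = (K-1)/(2Qα₁)` of `Ψ̄_{α₂}`,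
`α₂ = √K·α₁ = rate₂`), `Q = pᵉ`.

* `idealLaw_ne_le_fr` — the failure bound of `LWEPrimePowerIdeal.lean` under the top solver's
  specification RESTRICTED to systems of full column rank mod `p` (`LWEPrimePowerTopSpec.IsTopSolverFR`,
  the only systems the proof uses it on; the machine's Hensel-lifting solver meets it).
* `tvDist_spread_le`, `abs_pacc_hybridSamples_sub_le` — hybrids move by at most `m·Δ(χ, χ')` in
  acceptance probability when the noise law moves.
* **`abs_pacc_hybridSamples_sumNoise_sub_uniform_le`** — the instance of `hclose`: at a level `j` with
  `η_ε'(ℤ)`'s bound `√(ln(2(1+1/ε'))/π) ≤ pʲ·α₂`, every hybrid of `χK` is within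
  `m·ΔK + m·ε'/(1-ε')` of uniform in acceptance probability (levels `j > e` are uniform outright).
* **`prob_not_topGood_of_not_close_le`** — the instance of `hround`: at a step `i < e` that is NOT
  close (`pⁱ·α₂ < √(ln(2(1+1/ε'))/π)`), the rounding margin `(p^{e-i} - 1)/(2Q)` is at least
  `r₀ = α₂/(2·√(ln(2(1+1/ε'))/π)) - 1/(2Q)`, so `Pr[¬ TopGood (e-i)] ≤ (pᵈ-1)/p^{m'} + m'·2e^{-πr₀²/α₁²}`.
* **`idealLaw_gaussian_ne_le`** — the failure bound of the reduction with these noises, for every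
  secret, in terms of `Adv = Adv₂ - m·ΔK` (`Adv₂` the advantage against `Ψ̄_{α₂}`):
  `(e+1)/(4N'(Adv/8e)²) + d·e·(δ₀ + (p-1)δ₁) + (pᵈ-1)/p^{m'} + m'·2e^{-πr₀²/α₁²}`, under
  `2(m·ΔK + m·ε'/(1-ε')) < Adv/(2e)` and `0 ≤ r₀`.

## References

* D. Micciancio, C. Peikert, *Trapdoors for lattices: simpler, tighter, faster, smaller*, EUROCRYPT 2012,
  LNCS 7237; full version IACR ePrint 2011/501, §3, Thm. 3.1 and its proof, pp. 15–16 (read: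
  `lit read paper:doi-10-1007-978-3-642-29011-4-41`, p0015–p0016). [MicciancioPeikert2012]
* O. Regev, *On lattices, learning with errors, random linear codes, and cryptography*, J. ACM 56
  (2009), §2–§4. [RegevLWE2009]
-/

noncomputable section

open scoped ENNReal

namespace Literature.Computability.Cryptography

namespace LWE

namespace MP12

open Real

/-! ### Hybrids under a nearby noise law -/

section Nearby

variable {ι : Type} [Fintype ι] [DecidableEq ι] {q : ℕ} [NeZero q]

/-- Spreading is a randomised map of the noise: `Δ(spread χ g, spread χ' g) ≤ Δ(χ, χ')`. [folklore] -/
theorem tvDist_spread_le (χ χ' : PMF (ZMod q)) (g : ZMod q) : (spread χ g).tvDist (spread χ' g) ≤ χ.tvDist χ' := by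
  unfold spread
  exact PMF.tvDist_bind_le_of_forall_le _ _ _ fun r => PMF.tvDist_map_le_holds _ χ χ'

variable {m : ℕ} (Dk : (Fin m → (ι → ZMod q) × ZMod q) → PMF Bool)

/-- **A hybrid's acceptance probability moves by at most `m·Δ(χ, χ')` with the noise law.**
[cite: RegevLWE2009, Lemma 3.7 (proof)] -/
theorem abs_pacc_hybridSamples_sub_le (χ χ' : PMF (ZMod q)) (σ : ι → ZMod q) (g : ZMod q) (m : ℕ)
    (Dk : (Fin m → (ι → ZMod q) × ZMod q) → PMF Bool) :
    |pacc Dk (hybridSamples χ σ g m) - pacc Dk (hybridSamples χ' σ g m)| ≤ m * χ.tvDist χ' := by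
  unfold pacc hybridSamples
  refine (abs_acceptProb_toReal_sub_le_tvDist Dk _ _).trans ((tvDist_lweSamples_le _ _ σ m).trans ?_)
  gcongr
  exact tvDist_spread_le χ χ' g

end Nearby


/-! ### The failure bound with the restricted solver specification -/

section IdealFR

variable {d : ℕ} {p : ℕ} [hp : Fact p.Prime] {e : ℕ} {m : ℕ}
variable {Dk : (Fin m → (Fin d → ZMod (p ^ e)) × ZMod (p ^ e)) → PMF Bool} {χK χ₁ : PMF (ZMod (p ^ e))}
variable {N T N' m' : ℕ} {γ : ℝ}
variable {F : ℕ → (Fin m' → (Fin d → ZMod (p ^ e)) × ZMod (p ^ e)) → (Fin m' → ZMod (p ^ e)) → (Fin d → ZMod (p ^ e))}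

/-- **`LWEPrimePowerIdeal.idealLaw_ne_le` under the restricted solver specification** (same proof;
the specification is only used on the good event, where the matrix has full rank mod `p`).
[cite: MicciancioPeikert2012, Thm. 3.1 proof (pp. 15–16)] -/
theorem idealLaw_ne_le_fr (he : 0 < e) (hN : 0 < N) (hN' : 0 < N') (hF : ∀ a, IsTopSolverFR a he (F a))
    (s : Fin d → ZMod (p ^ e))
    {Adv : ℝ} (hAdv : 0 < Adv) (hAdvle : Adv ≤ distinguishingAdvantage χK m Dk)
    (hγ : γ = Adv / (4 * e))
    (Close : ℕ → Prop) (hmono : ∀ j, Close j → Close (j + 1)) {δc : ℝ}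
    (hclose : ∀ j σ', Close j →
      |pacc Dk (hybridSamples χK σ' (gen p e j) m) - pacc Dk (uniformSamples (Fin d) (ZMod (p ^ e)) m)| ≤ δc)
    (hδc : 2 * δc < Adv / (2 * e))
    {ρ : ℝ≥0∞} (hround : ∀ i < e, ¬ Close i → (lweSamples χ₁ s m').toOuterMeasure {S | ¬ TopGood (e - i) he s S} ≤ ρ) :
    (idealLaw Dk χK χ₁ N T N' m' γ F s).toOuterMeasure {x | x ≠ s} ≤
      (e + 1 : ℕ) * ENNReal.ofReal (1 / (4 * N' * (Adv / (8 * e)) ^ 2)) +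
        d * (e * ((ENNReal.ofReal (1 - γ) + ENNReal.ofReal (8 / (N * γ ^ 2))) ^ T +
          (p - 1 : ℕ) * (T * ENNReal.ofReal (8 / (N * γ ^ 2))))) + ρ := by
  have he' : (0 : ℝ) < e := by exact_mod_cast he
  set η : ℝ := Adv / (8 * e) with hη
  have hη0 : 0 < η := by positivity
  have hγ0 : 0 < γ := by rw [hγ]; positivity
  have hin : ∀ a ∈ {a | EstGood Dk χK (gen p e) e N' η a},
      ((digitsLaw Dk χK N T N' γ a s).bind fun Ls =>
          (lweSamples χ₁ s m').map fun S => recoverTop (e - selectStep e N' a) (F (e - selectStep e N' a)) S Ls).toOuterMeasure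
        {x | x ≠ s} ≤
      d * (e * ((ENNReal.ofReal (1 - γ) + ENNReal.ofReal (8 / (N * γ ^ 2))) ^ T +
          (p - 1 : ℕ) * (T * ENNReal.ofReal (8 / (N * γ ^ 2))))) + ρ := by
    intro a ha
    set i₀ := selectStep e N' a with hi₀
    have hi₀e : i₀ < e := selectStep_lt e N' he a
    have hgap : Adv / e - 4 * η ≤ |stepGap Dk χK (gen p e) i₀| :=
      abs_stepGap_selectStep_ge he ha ((exists_abs_stepGap_ge he (gen_zero p e) (isUnit_gen_self p e)).imp
        fun i hi => ⟨hi.1, le_trans (div_le_div_of_nonneg_right hAdvle he'.le) hi.2⟩)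
    have hgap' : Adv / (2 * e) ≤ |stepGap Dk χK (gen p e) i₀| := by
      have : Adv / e - 4 * η = Adv / (2 * e) := by rw [hη]; field_simp; ring
      rwa [this] at hgap
    have hG : GapHyp Dk χK (gen p e i₀) (gen p e (i₀ + 1)) γ :=
      gapHyp_of_abs_stepGap_ge i₀ (by rw [hγ]; convert hgap' using 1; field_simp; ring)
    have hnc : ¬ Close i₀ := not_close_of_abs_stepGap_gt hmono hclose (lt_of_lt_of_le hδc hgap')
    refine (toOuterMeasure_bind_le_add_of_point _ _ (lowVec (e - i₀) s) _).trans (add_le_add ?_ ?_)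
    · exact digitsLaw_ne_lowVec_le he hN hγ0 a hG s
    · rw [PMF.toOuterMeasure_map_apply]
      refine le_trans (MeasureTheory.measure_mono fun S hS => ?_) (hround i₀ hi₀e hnc)
      intro hgood
      exact hS (recoverTop_eq_of_topGood_fr (e - i₀) he (Nat.sub_le e i₀) (hF _) s hgood)
  have hest : (estLaw Dk χK (gen p e) e N').toOuterMeasure {a | EstGood Dk χK (gen p e) e N' η a}ᶜ ≤
      (e + 1 : ℕ) * ENNReal.ofReal (1 / (4 * N' * η ^ 2)) := by
    rw [Set.compl_setOf]
    exact prob_not_estGood_le hN' hη0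
  unfold idealLaw
  calc _ ≤ (estLaw Dk χK (gen p e) e N').toOuterMeasure {a | EstGood Dk χK (gen p e) e N' η a}ᶜ +
        (d * (e * ((ENNReal.ofReal (1 - γ) + ENNReal.ofReal (8 / (N * γ ^ 2))) ^ T +
          (p - 1 : ℕ) * (T * ENNReal.ofReal (8 / (N * γ ^ 2))))) + ρ) :=
        toOuterMeasure_bind_le_compl_add _ _ _ _ hin
    _ ≤ _ := by rw [add_assoc]; exact add_le_add hest le_rfl

end IdealFR

/-! ### The Gaussian instances of `hclose` and `hround` -/

section Gaussian

variable {d : ℕ} {p : ℕ} [hp : Fact p.Prime] {e : ℕ} {m : ℕ}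
variable (Dk : (Fin m → (Fin d → ZMod (p ^ e)) × ZMod (p ^ e)) → PMF Bool)

/-- **Instance of `hclose`**: at a level `j` above the smoothing bound, every hybrid of the aggregated
noise `sumNoise Ψ̄_{α₁} K` is within `m·(K-1)/(2Qα₁) + m·ε'/(1-ε')` of uniform in acceptance
probability. [cite: MicciancioPeikert2012, Lemma 2.4 with Thm. 3.1 proof (p. 15)] -/
theorem abs_pacc_hybridSamples_sumNoise_sub_uniform_le {α₁ : ℝ} (hα₁ : 0 < α₁) {K : ℕ} (hK : 1 ≤ K)
    {ε' : ℝ} (hε' : 0 < ε') (hε'1 : ε' < 1) {j : ℕ}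
    (hsl : Real.sqrt (Real.log (2 * (1 + 1 / ε')) / π) ≤ (p : ℝ) ^ j * (Real.sqrt K * α₁))
    (σ : Fin d → ZMod (p ^ e)) :
    |pacc Dk (hybridSamples (sumNoise (p ^ e) (discretizedGaussian (p ^ e) α₁) K) σ (gen p e j) m) -
        pacc Dk (uniformSamples (Fin d) (ZMod (p ^ e)) m)| ≤
      m * ((K - 1 : ℝ) / (2 * (p ^ e : ℕ) * α₁)) + m * (ε' / (1 - ε')) := by
  rcases le_or_gt j e with hje | hje
  · have hα₂ : 0 < Real.sqrt K * α₁ :=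
      mul_pos (Real.sqrt_pos.2 (by exact_mod_cast Nat.lt_of_lt_of_le Nat.zero_lt_one hK)) hα₁
    have h1 := abs_pacc_hybridSamples_sub_le (sumNoise (p ^ e) (discretizedGaussian (p ^ e) α₁) K)
      (discretizedGaussian (p ^ e) (Real.sqrt K * α₁)) σ (gen p e j) m Dk
    have h2 : |pacc Dk (hybridSamples (discretizedGaussian (p ^ e) (Real.sqrt K * α₁)) σ (gen p e j) m) -
        pacc Dk (uniformSamples (Fin d) (ZMod (p ^ e)) m)| ≤ m * (ε' / (1 - ε')) := by
      unfold pacc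
      exact (abs_acceptProb_toReal_sub_le_tvDist Dk _ _).trans
        (tvDist_hybridSamples_uniformSamples_le hje hε' hε'1 hα₂ hsl σ m)
    have h3 := tvDist_sumNoise_discretizedGaussian_le (p ^ e) hα₁ K hK
    calc _ ≤ |pacc Dk (hybridSamples (sumNoise (p ^ e) (discretizedGaussian (p ^ e) α₁) K) σ (gen p e j) m) -
            pacc Dk (hybridSamples (discretizedGaussian (p ^ e) (Real.sqrt K * α₁)) σ (gen p e j) m)| +
          |pacc Dk (hybridSamples (discretizedGaussian (p ^ e) (Real.sqrt K * α₁)) σ (gen p e j) m) -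
            pacc Dk (uniformSamples (Fin d) (ZMod (p ^ e)) m)| := abs_sub_le _ _ _
      _ ≤ m * ((K - 1 : ℝ) / (2 * (p ^ e : ℕ) * α₁)) + m * (ε' / (1 - ε')) := by
          refine add_le_add (h1.trans ?_) h2
          exact mul_le_mul_of_nonneg_left h3 (Nat.cast_nonneg m)
  · -- above `e` the hybrid is uniform
    have hunit : IsUnit (gen p e j) := by
      rw [gen, Nat.sub_eq_zero_of_le hje.le, pow_zero]
      exact isUnit_one
    rw [hybridSamples_of_isUnit _ σ hunit, sub_self, abs_zero]
    have : 0 ≤ (K - 1 : ℝ) / (2 * (p ^ e : ℕ) * α₁) := by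
      apply div_nonneg
      · have : (1 : ℝ) ≤ K := by exact_mod_cast hK
        linarith
      · positivity
    have : 0 ≤ ε' / (1 - ε') := div_nonneg hε'.le (by linarith)
    positivity

/-- **The rounding margin at a step that is not close**: if `pⁱ·α₂ < θ` (`i < e`, `0 < θ`) then
`(p^{e-i} - 1)/(2Q) ≥ α₂/(2θ) - 1/(2Q)`. [cite: MicciancioPeikert2012, Thm. 3.1 proof (p. 16: "`P/q ≥ α·ω(√(log n))`")] -/
theorem margin_ge_of_not_close {i : ℕ} (hie : i < e) {α₂ θ : ℝ} (hθ : 0 < θ)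
    (hnc : (p : ℝ) ^ i * α₂ < θ) :
    α₂ / (2 * θ) - 1 / (2 * (p ^ e : ℕ)) ≤ ((p ^ (e - i) : ℕ) - 1 : ℝ) / (2 * (p ^ e : ℕ)) := by
  have hp0 : (0 : ℝ) < p := by exact_mod_cast hp.out.pos
  have hQ : (0 : ℝ) < (p ^ e : ℕ) := by exact_mod_cast pow_pos hp.out.pos e
  -- `p^{e-i} · pⁱ = Q`
  have hsplit : ((p ^ (e - i) : ℕ) : ℝ) * (p : ℝ) ^ i = (p ^ e : ℕ) := by
    push_cast
    rw [← pow_add, Nat.sub_add_cancel hie.le]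
  -- `p^{e-i} ≥ Q α₂ / θ`
  have h1 : (p ^ e : ℕ) * α₂ / θ ≤ ((p ^ (e - i) : ℕ) : ℝ) := by
    rw [div_le_iff₀ hθ, ← hsplit, mul_assoc]
    exact mul_le_mul_of_nonneg_left hnc.le (by positivity)
  calc α₂ / (2 * θ) - 1 / (2 * (p ^ e : ℕ)) = ((p ^ e : ℕ) * α₂ / θ - 1) / (2 * (p ^ e : ℕ)) := by
        field_simp
    _ ≤ ((p ^ (e - i) : ℕ) - 1 : ℝ) / (2 * (p ^ e : ℕ)) :=
        div_le_div_of_nonneg_right (sub_le_sub_right h1 1) (by positivity)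

/-- **Instance of `hround`**: at a step `i < e` that is not close, the rounding of `m'` fresh raw
samples fails with probability `≤ (pᵈ-1)/p^{m'} + m'·2e^{-πr₀²/α₁²}`,
`r₀ = α₂/(2θ) - 1/(2Q) ≥ 0`, `θ = √(ln(2(1+1/ε'))/π)`. [cite: MicciancioPeikert2012, Thm. 3.1 proof (p. 16)] -/
theorem prob_not_topGood_of_not_close_le (he : 0 < e) {α₁ : ℝ} (hα₁ : 0 < α₁) {α₂ θ : ℝ}
    (hθ : 0 < θ) (hr₀ : 0 ≤ α₂ / (2 * θ) - 1 / (2 * (p ^ e : ℕ))) {i : ℕ} (hie : i < e)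
    (hnc : ¬ θ ≤ (p : ℝ) ^ i * α₂) (s : Fin d → ZMod (p ^ e)) (m' : ℕ) :
    (lweSamples (discretizedGaussian (p ^ e) α₁) s m').toOuterMeasure {S | ¬ TopGood (e - i) he s S} ≤
      ((p ^ d - 1 : ℕ) : ℝ≥0∞) / (p ^ m' : ℕ) +
        m' * ENNReal.ofReal (2 * exp (-(Real.pi * (α₂ / (2 * θ) - 1 / (2 * (p ^ e : ℕ))) ^ 2 / α₁ ^ 2))) := by
  refine (prob_not_topGood_discretizedGaussian_le (e - i) he hα₁ s m').trans ?_
  have hm := margin_ge_of_not_close hie hθ (lt_of_not_ge hnc)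
  gcongr _ + _ * ENNReal.ofReal (2 * exp (-(?_)))
  gcongr Real.pi * ?_ / _
  exact pow_le_pow_left₀ hr₀ hm 2

variable {Dk}
variable {N T N' m' : ℕ} {γ : ℝ}
  {F : ℕ → (Fin m' → (Fin d → ZMod (p ^ e)) × ZMod (p ^ e)) → (Fin m' → ZMod (p ^ e)) → (Fin d → ZMod (p ^ e))}

/-- **The failure bound of the Micciancio–Peikert reduction with Gaussian noise**, for every secret
`s`: raw noise `Ψ̄_{α₁}`, aggregated noise `sumNoise Ψ̄_{α₁} K` (the distinguisher's advantage `Adv₂`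
is against `Ψ̄_{√K·α₁}`), see the module docstring. [cite: MicciancioPeikert2012, Thm. 3.1 proof (pp. 15–16)] -/
theorem idealLaw_gaussian_ne_le (he : 0 < e) (hN : 0 < N) (hN' : 0 < N') (hF : ∀ a, IsTopSolverFR a he (F a))
    {α₁ : ℝ} (hα₁ : 0 < α₁) {K : ℕ} (hK : 1 ≤ K) {ε' : ℝ} (hε' : 0 < ε') (hε'1 : ε' < 1)
    {Adv₂ : ℝ} (hAdv₂ : Adv₂ ≤ distinguishingAdvantage (discretizedGaussian (p ^ e) (Real.sqrt K * α₁)) m Dk)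
    {Adv : ℝ} (hAdv : Adv = Adv₂ - m * ((K - 1 : ℝ) / (2 * (p ^ e : ℕ) * α₁))) (hAdv0 : 0 < Adv)
    (hγ : γ = Adv / (4 * e))
    (hδc : 2 * (m * ((K - 1 : ℝ) / (2 * (p ^ e : ℕ) * α₁)) + m * (ε' / (1 - ε'))) < Adv / (2 * e))
    (hr₀ : 0 ≤ Real.sqrt K * α₁ / (2 * Real.sqrt (Real.log (2 * (1 + 1 / ε')) / π)) - 1 / (2 * (p ^ e : ℕ)))
    (s : Fin d → ZMod (p ^ e)) :
    (idealLaw Dk (sumNoise (p ^ e) (discretizedGaussian (p ^ e) α₁) K) (discretizedGaussian (p ^ e) α₁)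
        N T N' m' γ F s).toOuterMeasure {x | x ≠ s} ≤
      (e + 1 : ℕ) * ENNReal.ofReal (1 / (4 * N' * (Adv / (8 * e)) ^ 2)) +
        d * (e * ((ENNReal.ofReal (1 - γ) + ENNReal.ofReal (8 / (N * γ ^ 2))) ^ T +
          (p - 1 : ℕ) * (T * ENNReal.ofReal (8 / (N * γ ^ 2))))) +
        (((p ^ d - 1 : ℕ) : ℝ≥0∞) / (p ^ m' : ℕ) +
          m' * ENNReal.ofReal (2 * exp (-(Real.pi *
            (Real.sqrt K * α₁ / (2 * Real.sqrt (Real.log (2 * (1 + 1 / ε')) / π)) - 1 / (2 * (p ^ e : ℕ))) ^ 2 / α₁ ^ 2)))) := by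
  set θ : ℝ := Real.sqrt (Real.log (2 * (1 + 1 / ε')) / π) with hθ
  have hKpos : (0 : ℝ) < K := by exact_mod_cast Nat.lt_of_lt_of_le Nat.zero_lt_one hK
  have hα₂ : 0 < Real.sqrt K * α₁ := mul_pos (Real.sqrt_pos.2 hKpos) hα₁
  have hθ0 : 0 < θ := by
    apply Real.sqrt_pos.2
    apply div_pos _ Real.pi_pos
    apply Real.log_pos
    have : 0 < 1 / ε' := by positivity
    linarith
  have hAdvle : Adv ≤ distinguishingAdvantage (sumNoise (p ^ e) (discretizedGaussian (p ^ e) α₁) K) m Dk := by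
    have h := distinguishingAdvantage_sumNoise_ge (n := d) (Q := p ^ e) hα₁ hK m Dk
    have hQ : ((p ^ e : ℕ) : ℝ) = ((p : ℝ) ^ e) := by push_cast; ring
    rw [hAdv]
    refine le_trans ?_ h
    rw [hQ]
    linarith
  refine idealLaw_ne_le_fr he hN hN' hF s hAdv0 hAdvle hγ (fun j => θ ≤ (p : ℝ) ^ j * (Real.sqrt K * α₁))
    (fun j hj => hj.trans ?_) (fun j σ' hj => abs_pacc_hybridSamples_sumNoise_sub_uniform_le Dk hα₁ hK hε' hε'1 hj σ')
    hδc (fun i hi hnc => prob_not_topGood_of_not_close_le he hα₁ hθ0 hr₀ hi hnc s m')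
  rw [pow_succ]
  have hp1 : (1 : ℝ) ≤ p := by exact_mod_cast hp.out.one_lt.le
  nlinarith [pow_pos (show (0 : ℝ) < p by linarith) j, hα₂]

end Gaussian

end MP12

end LWE

end Literature.Computability.Cryptography

end
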